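import Summits.BirchSwinnertonDyer.BirchSwinnertonDyer.Theorems.QuadraticBranchSignedControlPlusEtaNonsurjMinusCoeffCongruence
import Summits.BirchSwinnertonDyer.Rank1Residual.Additive.QuadraticBranchPlusLFunctionExistence
import Summits.BirchSwinnertonDyer.Rank1Residual.Additive.QuadraticBranchPlusLFunctionUnique
import HarnessLib

/-!
# Route `QuadraticBranchSignedControl` (rung K8, cell `bsd-potss`), residual crux `PlusEtaMainConjectureNonsurj`
# (stmt-BirchSwinnertonDyer-19606): THE θ-COEFFICIENT CONGRUENCE, PLUS SIDE — `coeff₀` and `coeff₁` of Kobayashi's `L_p⁺(V, η, X)`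
# read off the EVEN-level Mazur–Tate elements `θ_{2m}(η)` (seat `bsd-potss-k8eta-c2` g24; twin of `…MinusCoeffCongruence.lean`)

WHY. Every rank-one `BSD_p` record of this crux displays `hX` «`(L_p⁺(V,η,X)) = (X)` for every plus branch function `Lη`
(`IsQuadraticBranchPlusLFunction f p ϖ Lη`)» (PARI `λ⁺ = 1, μ⁺ = 0`): `Lη(0) = 0` and `coeff₁ Lη ∈ ℤ_pˣ`. With bsd-potss-ctrl's
EVEN-level limit `M⁺` (`exists_isCongrModOmega_quadraticBranch_even`: `θ_{2m}(η) ≡ (−1)^{m+1} ω⁻_{2m} M⁺ (mod ω_{2m})`,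
`Additive/QuadraticBranchPlusLFunctionExistence.lean`) THIS FILE proves the plus twin of the θ-coefficient congruence:
`coeff₀ θ_{2m}(η) = (−1)^{m+1} p^m coeff₀ M⁺` EXACTLY and `coeff₁ θ_{2m}(η) = (−1)^{m+1}(p^m coeff₁ M⁺ + (coeff₁ ω⁻_{2m}) coeff₀ M⁺) + p^{2m} r`
(`ω⁻_{2m}(0) = p^m`, `ω_{2m}(0) = 0`, `coeff₁ ω_{2m} = p^{2m}`), and that every plus branch function is `v · ϖ · M⁺` (`v ∈ ℤ_pˣ`)
coefficientwise — so `coeff₁ L_p⁺(V,η,X)` is, in rank one, read off ONE displayed rational `ϖ · coeff₁ θ₂(η)` (sequel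
`…PlusCoeffCongruenceReadings.lean`: `hX` PRODUCED from `v_p(ϖ·coeff₁θ₂(η)) = 1` and `L(W,1) = 0`).

WHAT. §1 `coeff_zero_cyclotomicOmegaMinus_two_mul` (`= p^m`); §2 `isQuadraticBranchPlusLFunction_one_of_isCongrModOmega_even` (the even
limit IS a plus branch function with `ϖ = 1`, bsd-potss-ctrl's existence proof unbundled), `isQuadraticBranchPlusLFunction_C_mul`,
`exists_units_forall_coeff_eq_plus` (`coeff_k L = v·ϖ·coeff_k M⁺` for all `k`); §3 `coeff_zero_mazurTate_plus_eq`, `exists_coeff_one_mazurTate_plus_eq`.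

HONEST FRAMING (cell `bsd-potss`; FULL-BSD rank ≤ 1 programme, HUMAN RULING D-0036/D-0074): TOOL THEOREMS ONLY — no definition, no named
fact, no `sorry`, axioms standard; nothing about (A), (C1⁺_η), C-cc-1 or `BSD(W,p)` of any pair is claimed; no stub of 19606 is proved; crux and
route OPEN; nothing booked. `--supports stmt-BirchSwinnertonDyer-19606`.

References: [Kobayashi2003] Thm. 3.2, (3.4), (3.6) (p. 7); [Pollack2003] Prop. 6.18, §6.5; [MazurTateTeitelbaum1986Invent] §I.13. Tree:
`Additive/QuadraticBranchPlusLFunction{Existence,Unique}.lean`, `…MinusCoeffCongruence.lean` (the generic integral congruence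
`exists_sub_eq_omega_mul_of_isCongrModOmega`, `coeff_one_mul`, `coeff_{zero,one}_cyclotomicOmega`).
-/

set_option autoImplicit false
set_option linter.dupNamespace false
noncomputable section

open scoped Classical MatrixGroups ModularForm

open CongruenceSubgroup Polynomial Literature.NumberTheory.EllipticCurves
  Literature.NumberTheory.EllipticCurves.ModularForms
open Summit.BirchSwinnertonDyer.Rank1Residual.Additive
open Summit.BirchSwinnertonDyer.BirchSwinnertonDyer.Theorems.EtaMinusCoeffCongruence

namespace Summit.BirchSwinnertonDyer.BirchSwinnertonDyer.Theorems.EtaPlusCoeffCongruence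

variable {p : ℕ} [hp : Fact p.Prime]

/-! ## §1 `ω⁻_{2m}(0) = p^m` -/

/-- `ω⁻_{2m}(0) = p^m`: `ω⁻_0 = 1`, `ω⁻_{2m+2} = ω⁻_{2m+1} = Φ_p(1+X) ∏_{i<m} Φ_{p^{2i+3}}(1+X)` and `Φ_{p^k}(1) = p`.
[cite: Pollack2003, §6.5 (display before Prop. 6.18)] -/
theorem coeff_zero_cyclotomicOmegaMinus_two_mul (m : ℕ) :
    (cyclotomicOmegaMinus p (2 * m)).coeff 0 = (p : ℤ) ^ m := by
  rcases m with _ | m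
  · simp
  · rw [show 2 * (m + 1) = 2 * m + 2 by ring, ← cyclotomicOmegaMinus_two_mul_add_one,
      cyclotomicOmegaMinus_two_mul_add_one_eq_prod, coeff_zero_eq_eval_zero, eval_mul, eval_prod, eval_comp,
      eval_add, eval_X, eval_one, zero_add, eval_one_cyclotomic_prime]
    have h : ∀ i ∈ Finset.range m, eval 0 ((cyclotomic (p ^ (2 * i + 3)) ℤ).comp (X + 1)) = (p : ℤ) := by
      intro i _
      rw [eval_comp, eval_add, eval_X, eval_one, zero_add, show 2 * i + 3 = (2 * i + 2) + 1 from rfl,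
        eval_one_cyclotomic_prime_pow]
    rw [Finset.prod_congr rfl h, Finset.prod_const, Finset.card_range, pow_succ']

/-! ## §2 From the even-level limit `M⁺` to every `L_p⁺(V, η, X)` -/

section Transfer

variable {N : ℕ} [NeZero N] {f : CuspForm (Gamma0 N) 2}

omit [NeZero N] in
/-- **The even-level Mazur–Tate limit IS a plus branch function with period ratio `1`** (bsd-potss-ctrl's
`exists_isQuadraticBranchPlusLFunction`, UNBUNDLED so that the congruences and the interpolation property hold for the SAME `M`): if
`θ_{2m}(η) ≡ (−1)^{m+1} ω⁻_{2m} M (mod ω_{2m})` for every `m` then `M` has Kobayashi's (3.4)/(3.6) with `u = 1`, `ϖ = 1` (evaluate the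
congruence at `ζ − 1`, `ζ = ψ(γ)` of order `p^{2m}` — at `m = 0`, `ζ = 1`). [cite: Kobayashi2003, Thm. 3.2, (3.4) and (3.6) (p. 7)]
[cite: Pollack2003, Prop. 6.18] -/
theorem isQuadraticBranchPlusLFunction_one_of_isCongrModOmega_even (hp2 : p ≠ 2) {M : IwasawaAlgebra p}
    (hM : ∀ m : ℕ, IsCongrModOmega p (2 * m) (quadraticBranchMazurTateElement p f (2 * m))
      ((-1) ^ (m + 1) * cyclotomicOmegaMinus p (2 * m)) M) :
    IsQuadraticBranchPlusLFunction f p 1 M := by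
  have he : cyclotomicExponent p = 1 := if_neg hp2
  set ι : ℤ_[p] →+* ℂ_[p] := (algebraMap ℚ_[p] ℂ_[p]).comp (algebraMap ℤ_[p] ℚ_[p]) with hι
  refine ⟨1, fun n hn ψ hψ ↦ ?_⟩
  have key : ∀ (K : ℕ) (hK : K = n + cyclotomicExponent p)
      (ψ : DirichletCharacter ℂ_[p] (p ^ K)), orderOf ψ = 2 * p ^ n →
      HasSum (fun k : ℕ ↦ ι (PowerSeries.coeff k M) * (ψ (cyclotomicGenerator p : ZMod (p ^ K)) - 1) ^ k)
        ((-1 : ℂ_[p]) ^ (n / 2 + 1) *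
          (if Even (p / 2) then ratTwistedSymbolSum f ψ else ratMinusTwistedSymbolSum f ψ) /
          (cyclotomicOmegaMinus p n).eval₂ (algebraMap ℤ ℂ_[p])
            (ψ (cyclotomicGenerator p : ZMod (p ^ K)) - 1)) := by
    intro K hK ψ hψ
    subst hK
    obtain ⟨m, rfl⟩ := hn
    set ζ : ℂ_[p] := ψ (cyclotomicGenerator p : ZMod (p ^ (m + m + cyclotomicExponent p))) with hζ
    have hordζ := orderOf_apply_cyclotomicGenerator_of_orderOf_eq hp2 ψ hψ
    have hprim : IsPrimitiveRoot ζ (p ^ (m + m)) := hordζ ▸ IsPrimitiveRoot.orderOf ζ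
    have hpow : ζ ^ p ^ (m + m) = 1 := hordζ ▸ pow_orderOf_eq_one ζ
    have hz : ‖ζ - 1‖ < 1 := norm_sub_one_lt_one_of_pow_prime_pow_eq_one hpow
    have hzn : (1 + (ζ - 1)) ^ p ^ (m + m) = 1 := by rwa [add_sub_cancel]
    have hω : (cyclotomicOmegaMinus p (m + m)).eval₂ (algebraMap ℤ ℂ_[p]) (ζ - 1) ≠ 0 :=
      eval₂_cyclotomicOmegaMinus_ne_zero ⟨m, rfl⟩ hprim
    have h1 := (hM m).eval₂_eq hz (by rw [two_mul]; exact hzn)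
    rw [two_mul, eval₂_quadraticBranchMazurTateElement_eq f hp2 ψ hψ, eval₂_mul, eval₂_pow,
      eval₂_neg, eval₂_one] at h1
    have hsum : HasSum (fun k ↦ ι (PowerSeries.coeff k M) * (ζ - 1) ^ k)
        (∑' k, ι (PowerSeries.coeff k M) * (ζ - 1) ^ k) :=
      (summable_map_coeff_mul_pow _ (norm_algebraMap_coeff_le_one M) hz).hasSum
    have hval : ∑' k, ι (PowerSeries.coeff k M) * (ζ - 1) ^ k =
        (-1 : ℂ_[p]) ^ ((m + m) / 2 + 1) *
          (if Even (p / 2) then ratTwistedSymbolSum f ψ else ratMinusTwistedSymbolSum f ψ) /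
          (cyclotomicOmegaMinus p (m + m)).eval₂ (algebraMap ℤ ℂ_[p]) (ζ - 1) := by
      rw [show (m + m) / 2 + 1 = m + 1 by omega, eq_div_iff hω, h1, hι]
      have hs : ((-1 : ℂ_[p]) ^ (m + 1)) * (-1) ^ (m + 1) = 1 := by
        rw [← mul_pow, neg_one_mul, neg_neg, one_pow]
      linear_combination (-((cyclotomicOmegaMinus p (m + m)).eval₂ (algebraMap ℤ ℂ_[p]) (ζ - 1) *
        ∑' k, ι (PowerSeries.coeff k M) * (ζ - 1) ^ k)) * hs
    rwa [hval] at hsum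
  have hone : algebraMap ℚ_[p] ℂ_[p] ((((1 : ℤ_[p]ˣ) : ℤ_[p]) : ℚ_[p]) * ((1 : ℚ) : ℚ_[p])) = 1 := by
    rw [Units.val_one, PadicInt.coe_one, Rat.cast_one, mul_one, map_one]
  rw [hone, mul_one]
  exact key (n + 1) (by rw [he]) ψ hψ

omit [NeZero N] in
/-- **Scaling a plus branch function by a `p`-adic integer**: `c = r ∈ ℚ` gives period ratio `r·ϖ` for `c·L` (same unit).
[cite: Kobayashi2003, Thm. 3.2 and (3.4) (p. 7)] -/
theorem isQuadraticBranchPlusLFunction_C_mul {ϖ : ℚ} {L : IwasawaAlgebra p}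
    (hL : IsQuadraticBranchPlusLFunction f p ϖ L) (c : ℤ_[p]) (r : ℚ)
    (hc : ((c : ℤ_[p]) : ℚ_[p]) = (r : ℚ_[p])) :
    IsQuadraticBranchPlusLFunction f p (r * ϖ) (PowerSeries.C c * L) := by
  obtain ⟨u, H⟩ := hL
  refine ⟨u, fun n hn ψ hψ ↦ ?_⟩
  have h := (H n hn ψ hψ).mul_left (algebraMap ℚ_[p] ℂ_[p] (r : ℚ_[p]))
  have hιc : ((algebraMap ℚ_[p] ℂ_[p]).comp (algebraMap ℤ_[p] ℚ_[p])) c =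
      algebraMap ℚ_[p] ℂ_[p] (r : ℚ_[p]) := by
    rw [RingHom.comp_apply, PadicInt.algebraMap_apply, hc]
  have hfun : (fun k : ℕ ↦ ((algebraMap ℚ_[p] ℂ_[p]).comp (algebraMap ℤ_[p] ℚ_[p]))
        (PowerSeries.coeff k (PowerSeries.C c * L)) *
      (ψ (cyclotomicGenerator p : ZMod (p ^ (n + 1))) - 1) ^ k) =
      fun k ↦ algebraMap ℚ_[p] ℂ_[p] (r : ℚ_[p]) *
        (((algebraMap ℚ_[p] ℂ_[p]).comp (algebraMap ℤ_[p] ℚ_[p])) (PowerSeries.coeff k L) *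
          (ψ (cyclotomicGenerator p : ZMod (p ^ (n + 1))) - 1) ^ k) := by
    funext k
    rw [PowerSeries.coeff_C_mul, map_mul, hιc, mul_assoc]
  have hvalue : (-1 : ℂ_[p]) ^ (n / 2 + 1) *
        algebraMap ℚ_[p] ℂ_[p] (((u : ℤ_[p]) : ℚ_[p]) * (((r * ϖ : ℚ)) : ℚ_[p])) *
        (if Even (p / 2) then ratTwistedSymbolSum f ψ else ratMinusTwistedSymbolSum f ψ) /
        (cyclotomicOmegaMinus p n).eval₂ (algebraMap ℤ ℂ_[p])
          (ψ (cyclotomicGenerator p : ZMod (p ^ (n + 1))) - 1) =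
      algebraMap ℚ_[p] ℂ_[p] (r : ℚ_[p]) * ((-1 : ℂ_[p]) ^ (n / 2 + 1) *
        algebraMap ℚ_[p] ℂ_[p] (((u : ℤ_[p]) : ℚ_[p]) * (ϖ : ℚ_[p])) *
        (if Even (p / 2) then ratTwistedSymbolSum f ψ else ratMinusTwistedSymbolSum f ψ) /
        (cyclotomicOmegaMinus p n).eval₂ (algebraMap ℤ ℂ_[p])
          (ψ (cyclotomicGenerator p : ZMod (p ^ (n + 1))) - 1)) := by
    rw [Rat.cast_mul, map_mul, map_mul, map_mul]
    ring
  rw [hfun, hvalue]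
  exact h

omit [NeZero N] in
/-- **Every plus branch function is a unit multiple of `ϖ · M⁺`, coefficient by coefficient**: for `‖ϖ‖_p ≤ 1` and `L` with
`IsQuadraticBranchPlusLFunction f p ϖ L` there is `v ∈ ℤ_pˣ` with `coeff_k L = v · ϖ · coeff_k M⁺` for every `k` (`ϖ·M⁺` is a solution
for `ϖ`; x1b's uniqueness `IsQuadraticBranchPlusLFunction.exists_units_smul_eq`). [cite: Kobayashi2003, Thm. 3.2 and (3.4) (p. 7)]
[cite: Pollack2003, Prop. 6.18] -/
theorem exists_units_forall_coeff_eq_plus (hp2 : p ≠ 2) {ϖ : ℚ} (hϖ : ‖(ϖ : ℚ_[p])‖ ≤ 1)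
    {L M : IwasawaAlgebra p} (hL : IsQuadraticBranchPlusLFunction f p ϖ L)
    (hM : ∀ m : ℕ, IsCongrModOmega p (2 * m) (quadraticBranchMazurTateElement p f (2 * m))
      ((-1) ^ (m + 1) * cyclotomicOmegaMinus p (2 * m)) M) :
    ∃ v : ℤ_[p]ˣ, ∀ k : ℕ, ((PowerSeries.coeff k L : ℤ_[p]) : ℚ_[p]) =
      ((v : ℤ_[p]) : ℚ_[p]) * ((ϖ : ℚ_[p]) * ((PowerSeries.coeff k M : ℤ_[p]) : ℚ_[p])) := by
  set c : ℤ_[p] := ⟨(ϖ : ℚ_[p]), hϖ⟩ with hc_def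
  have hcϖ : ((c : ℤ_[p]) : ℚ_[p]) = (ϖ : ℚ_[p]) := rfl
  have h1 := isQuadraticBranchPlusLFunction_one_of_isCongrModOmega_even hp2 hM
  have h2 := isQuadraticBranchPlusLFunction_C_mul h1 c ϖ hcϖ
  rw [mul_one] at h2
  obtain ⟨v, hv⟩ := h2.exists_units_smul_eq hp2 hL
  refine ⟨v, fun k ↦ ?_⟩
  rw [hv, PowerSeries.coeff_smul, PowerSeries.coeff_C_mul, smul_eq_mul, PadicInt.coe_mul, PadicInt.coe_mul, hcϖ]

end Transfer

/-! ## §3 The coefficients of `1` and `X` of the even-level limit, read off `θ_{2m}(η)` -/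

section MazurTate

variable {N : ℕ} [NeZero N] {f : CuspForm (Gamma0 N) 2}

/-- **`coeff₀ θ_{2m}(η) = (−1)^{m+1} p^m · M⁺(0)` EXACTLY** (`M⁺` the even-level limit): compare the constant terms in
`Θ − (−1)^{m+1} ω⁻_{2m} M⁺ = ω_{2m} q` (`ω⁻_{2m}(0) = p^m`, `ω_{2m}(0) = 0`). At `m = 0` this is Kobayashi's (3.6): `M⁺(0) = −θ₀(η)(0)
= −∑_a η(a)[a/p]^δ_f`. [cite: Kobayashi2003, (3.6) (p. 7)] [cite: Pollack2003, Prop. 6.18] -/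
theorem coeff_zero_mazurTate_plus_eq (hp2 : p ≠ 2) (hf0 : IsNewform0 f) (hQ : coeffField f = ⊥)
    (hpN : ¬ p ∣ N) (hap : cuspCoeff f p = ((0 : ℤ) : ℂ)) (m : ℕ) {M : IwasawaAlgebra p}
    (hM : IsCongrModOmega p (2 * m) (quadraticBranchMazurTateElement p f (2 * m))
      ((-1) ^ (m + 1) * cyclotomicOmegaMinus p (2 * m)) M) :
    (((quadraticBranchMazurTateElement p f (2 * m)).coeff 0 : ℚ) : ℚ_[p]) =
      (-1) ^ (m + 1) * (p : ℚ_[p]) ^ m * ((PowerSeries.constantCoeff M : ℤ_[p]) : ℚ_[p]) := by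
  obtain ⟨Θ, q, hΘ, hid⟩ := exists_sub_eq_omega_mul_of_isCongrModOmega hp2 hf0 hQ hpN hap hM
  have hω0 : (((-1) ^ (m + 1) * cyclotomicOmegaMinus p (2 * m)).map (Int.castRingHom ℤ_[p])).coeff 0 =
      (-1) ^ (m + 1) * (p : ℤ_[p]) ^ m := by
    rw [Polynomial.coeff_map, coeff_zero_eq_eval_zero, eval_mul, eval_pow, eval_neg, eval_one,
      ← coeff_zero_eq_eval_zero, coeff_zero_cyclotomicOmegaMinus_two_mul]
    simp
  have hΩ0 : ((cyclotomicOmega p (2 * m)).map (Int.castRingHom ℤ_[p])).coeff 0 = 0 := by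
    rw [Polynomial.coeff_map, coeff_zero_cyclotomicOmega, map_zero]
  have h0 := congrArg (PowerSeries.coeff 0) hid
  rw [map_sub, PowerSeries.coeff_zero_eq_constantCoeff_apply, PowerSeries.coeff_zero_eq_constantCoeff, map_mul,
    map_mul] at h0
  simp only [← PowerSeries.coeff_zero_eq_constantCoeff_apply, Polynomial.coeff_coe] at h0
  rw [hω0, hΩ0, zero_mul] at h0
  have hΘ0 : Θ.coeff 0 = (-1) ^ (m + 1) * (p : ℤ_[p]) ^ m * PowerSeries.coeff 0 M := by
    linear_combination h0
  have hc := congrArg (fun P : ℚ_[p][X] ↦ P.coeff 0) hΘ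
  simp only [Polynomial.coeff_map, eq_ratCast] at hc
  rw [← hc, PadicInt.algebraMap_apply, hΘ0, PowerSeries.coeff_zero_eq_constantCoeff]
  push_cast
  ring

/-- **`coeff₁ θ_{2m}(η) = (−1)^{m+1} (p^m coeff₁ M⁺ + coeff₁(ω⁻_{2m}) · M⁺(0)) + p^{2m} r`** for some `r ∈ ℤ_p`: compare the coefficients
of `X` in `Θ − (−1)^{m+1} ω⁻_{2m} M⁺ = ω_{2m} q` (`coeff₁ ω_{2m} = p^{2m}`, `ω_{2m}(0) = 0`). When `M⁺(0) = 0` (analytic rank `≥ 1`) this is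
`coeff₁ θ_{2m}(η) = (−1)^{m+1} p^m coeff₁ M⁺ + p^{2m} r`. [cite: Pollack2003, Prop. 6.18] [cite: MazurTateTeitelbaum1986Invent, §I.13] -/
theorem exists_coeff_one_mazurTate_plus_eq (hp2 : p ≠ 2) (hf0 : IsNewform0 f) (hQ : coeffField f = ⊥)
    (hpN : ¬ p ∣ N) (hap : cuspCoeff f p = ((0 : ℤ) : ℂ)) (m : ℕ) {M : IwasawaAlgebra p}
    (hM : IsCongrModOmega p (2 * m) (quadraticBranchMazurTateElement p f (2 * m))
      ((-1) ^ (m + 1) * cyclotomicOmegaMinus p (2 * m)) M) :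
    ∃ r : ℤ_[p], (((quadraticBranchMazurTateElement p f (2 * m)).coeff 1 : ℚ) : ℚ_[p]) =
      (-1) ^ (m + 1) * ((p : ℚ_[p]) ^ m * ((PowerSeries.coeff 1 M : ℤ_[p]) : ℚ_[p]) +
        ((((cyclotomicOmegaMinus p (2 * m)).coeff 1 : ℤ) : ℚ_[p]) *
          ((PowerSeries.constantCoeff M : ℤ_[p]) : ℚ_[p]))) +
        (p : ℚ_[p]) ^ (2 * m) * (r : ℚ_[p]) := by
  obtain ⟨Θ, q, hΘ, hid⟩ := exists_sub_eq_omega_mul_of_isCongrModOmega hp2 hf0 hQ hpN hap hM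
  refine ⟨PowerSeries.constantCoeff q, ?_⟩
  have hω0 : (((-1) ^ (m + 1) * cyclotomicOmegaMinus p (2 * m)).map (Int.castRingHom ℤ_[p])).coeff 0 =
      (-1) ^ (m + 1) * (p : ℤ_[p]) ^ m := by
    rw [Polynomial.coeff_map, coeff_zero_eq_eval_zero, eval_mul, eval_pow, eval_neg, eval_one,
      ← coeff_zero_eq_eval_zero, coeff_zero_cyclotomicOmegaMinus_two_mul]
    simp
  have hω1 : (((-1) ^ (m + 1) * cyclotomicOmegaMinus p (2 * m)).map (Int.castRingHom ℤ_[p])).coeff 1 =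
      (-1) ^ (m + 1) * (((cyclotomicOmegaMinus p (2 * m)).coeff 1 : ℤ) : ℤ_[p]) := by
    rw [Polynomial.coeff_map, show ((-1 : ℤ[X]) ^ (m + 1)) = C ((-1 : ℤ) ^ (m + 1)) by simp, coeff_C_mul]
    simp
  have hΩ0 : ((cyclotomicOmega p (2 * m)).map (Int.castRingHom ℤ_[p])).coeff 0 = 0 := by
    rw [Polynomial.coeff_map, coeff_zero_cyclotomicOmega, map_zero]
  have hΩ1 : ((cyclotomicOmega p (2 * m)).map (Int.castRingHom ℤ_[p])).coeff 1 = (p : ℤ_[p]) ^ (2 * m) := by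
    rw [Polynomial.coeff_map, coeff_one_cyclotomicOmega]
    simp
  have h1 := congrArg (PowerSeries.coeff 1) hid
  rw [map_sub, EtaMinusCoeffCongruence.coeff_one_mul, EtaMinusCoeffCongruence.coeff_one_mul] at h1
  simp only [Polynomial.coeff_coe] at h1
  rw [hω0, hω1, hΩ0, hΩ1, zero_mul, zero_add, PowerSeries.coeff_zero_eq_constantCoeff] at h1
  have hΘ1 : Θ.coeff 1 = (-1) ^ (m + 1) * ((p : ℤ_[p]) ^ m * PowerSeries.coeff 1 M +
      (((cyclotomicOmegaMinus p (2 * m)).coeff 1 : ℤ) : ℤ_[p]) * PowerSeries.constantCoeff M) +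
      (p : ℤ_[p]) ^ (2 * m) * PowerSeries.constantCoeff q := by
    linear_combination h1
  have hc := congrArg (fun P : ℚ_[p][X] ↦ P.coeff 1) hΘ
  simp only [Polynomial.coeff_map, eq_ratCast] at hc
  rw [← hc, PadicInt.algebraMap_apply, hΘ1]
  push_cast
  ring

end MazurTate

end Summit.BirchSwinnertonDyer.BirchSwinnertonDyer.Theorems.EtaPlusCoeffCongruence

end
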